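import Summits.ValiantsHypothesis.ValiantsHypothesis.Theorems.LacunarySymmetroidMatrixDescartesCensusTopKill
import Summits.ValiantsHypothesis.ValiantsHypothesis.Theorems.LacunarySymmetroidMatrixDescartesCensusTwistedRolleMult

/-!
# `MatrixDescartes` census — TOP-KILL and the trinomial lemma with positive roots counted WITH MULTIPLICITY

HONEST FRAMING.  Object-search cell `pub-symmetroid`, route crux `Theses.LacunarySymmetroid.MatrixDescartes`
(ledger item stmt-ValiantsHypothesis-18050).  Elementary real-root tools about ONE real polynomial in the currency
`#Z₊^{mult}(f) = f.roots.countP (0 < ·)` (positive roots with multiplicity, the currency of Mathlib's Descartes rule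
`Polynomial.roots_countP_pos_le_signVariations`), companions of `…CensusTwistedRolleMult.lean`:

* TOP-KILL with multiplicity (`countP_posRoots_le_countP_posRoots_topTwist_of_topKill`): if the two HIGHEST
  coefficients of `f` have the same sign then the Euler twist at the top exponent `n = natDegree f` loses no
  positive root, multiplicities included: `#Z₊^{mult}(f) ≤ #Z₊^{mult}(X·f′ − n·f)` (the tree's
  `card_posRoots_le_card_posRoots_topTwist_of_topKill` is the distinct-root form);
* the TRINOMIAL LEMMA with multiplicity (`trinomial_two_posRoots_le_of_countP`): two positive roots of
  `A Xⁱ + B X^{i+a} + C X^{i+a+b}` COUNTED WITH MULTIPLICITY (a double root allowed) force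
  `(a+b)^{a+b} |A|^b |C|^a ≤ |B|^{a+b} a^a b^b` (the tree's `trinomial_two_posRoots_le` needs two distinct
  roots; at a double positive root the inequality is an equality).

These are the remaining tools for THEOREM N″ (`…CensusWindowNMult.lean`).  Nothing here bears on `ζ_sym`,
`DoorA26`/`DoorA34`, the crux, or `VP ≠ VNP`.

[folklore] Rolle with multiplicity, weighted AM–GM; no single source.
-/

-- `Summit.ValiantsHypothesis.ValiantsHypothesis.…` repeats a component by the D-0017 layout
-- (single-conjunct summit), which the `dupNamespace` linter flags; the name is mandated.
set_option linter.dupNamespace false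

namespace Summit.ValiantsHypothesis.ValiantsHypothesis.Theorems.LacunarySymmetroidMatrixDescartes.Census

open Polynomial Finset Set
open scoped BigOperators Polynomial

/-! ### TOP-KILL with multiplicity -/

/-- **TOP-KILL LEMMA, with multiplicity (positive normalisation).**  `n = natDegree f ≥ m ≥ 1`,
`f.coeff j = 0` for `n − m < j < n`, `f.leadingCoeff > 0`, `f.coeff (n − m) > 0` ⇒
`#Z₊^{mult}(f) ≤ #Z₊^{mult}(X·f′ − n·f)`: Rolle roots of the twist between consecutive positive roots of `f`, one
more beyond the largest root (`f/xⁿ` overshoots its limit and returns), and the multiplicity transfer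
`rootMultiplicity_le_rootMultiplicity_twist_succ`. [folklore] -/
theorem countP_posRoots_le_countP_posRoots_topTwist_of_topKill_pos (f : ℝ[X]) {m : ℕ} (hm : 1 ≤ m)
    (hmn : m ≤ f.natDegree) (hgap : ∀ j, f.natDegree - m < j → j < f.natDegree → f.coeff j = 0)
    (ha : 0 < f.leadingCoeff) (hb : 0 < f.coeff (f.natDegree - m)) :
    f.roots.countP (fun x => 0 < x) ≤
      (X * derivative f - C (f.natDegree : ℝ) * f).roots.countP (fun x => 0 < x) := by
  classical
  set n := f.natDegree with hn
  have hn1 : 1 ≤ n := hm.trans hmn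
  have hf : f ≠ 0 := fun h0 => by rw [h0, leadingCoeff_zero] at ha; exact lt_irrefl 0 ha
  set g : ℝ[X] := X * derivative f - C (n : ℝ) * f with hg
  -- `g.coeff (n - m) = -m · f.coeff (n-m) ≠ 0`, so `g ≠ 0`
  have hgc : g.coeff (n - m) = (((n - m : ℕ) : ℝ) - n) * f.coeff (n - m) := by
    rw [hg, coeff_X_mul_derivative_sub_C_mul]
  have hgne : g ≠ 0 := by
    intro h0
    rw [h0, coeff_zero] at hgc
    have : (((n - m : ℕ) : ℝ) - n) * f.coeff (n - m) ≠ 0 := by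
      apply mul_ne_zero _ hb.ne'
      have : ((n - m : ℕ) : ℝ) = (n : ℝ) - m := by push_cast [Nat.cast_sub hmn]; ring
      rw [this]
      have : (0 : ℝ) < m := by exact_mod_cast hm
      linarith
    exact this hgc.symm
  set s := f.roots.toFinset.filter (fun x => 0 < x) with hs
  set t := g.roots.toFinset.filter (fun x => 0 < x) with ht
  have hmem_s : ∀ x, x ∈ s ↔ f.IsRoot x ∧ 0 < x := by
    intro x; rw [hs, Finset.mem_filter, Multiset.mem_toFinset, mem_roots hf]
  have hmem_t : ∀ x, x ∈ t ↔ g.IsRoot x ∧ 0 < x := by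
    intro x; rw [ht, Finset.mem_filter, Multiset.mem_toFinset, mem_roots hgne]
  -- multiplicity transfer at the positive roots of `f`
  have hmult : ∀ x ∈ s, f.rootMultiplicity x ≤ g.rootMultiplicity x + 1 :=
    fun x _ => rootMultiplicity_le_rootMultiplicity_twist_succ f (n : ℝ) x hgne
  -- the quotient `φ = f / Xⁿ` and its derivative `g / X^{n+1}` on `(0, ∞)`
  set φ : ℝ → ℝ := fun u => f.eval u / u ^ n with hφ
  have hφderiv : ∀ x, 0 < x → HasDerivAt φ (g.eval x / x ^ (n + 1)) x :=
    fun x hx => hasDerivAt_eval_div_pow f hn1 hx.ne'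
  have hφcont : ∀ a b, 0 < a → ContinuousOn φ (Icc a b) := by
    intro a b ha' x hx
    exact ((hφderiv x (lt_of_lt_of_le ha' hx.1)).continuousAt).continuousWithinAt
  have hφdiff : ∀ a b, 0 < a → DifferentiableOn ℝ φ (Ioo a b) := by
    intro a b ha' x hx
    exact ((hφderiv x (ha'.trans hx.1)).differentiableAt).differentiableWithinAt
  -- Rolle between consecutive positive roots: a root of `g`
  have rolle : ∀ x y, 0 < x → x < y → f.eval x = 0 → f.eval y = 0 → ∃ z, x < z ∧ z < y ∧ g.IsRoot z := by
    intro x y hx hxy hfx hfy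
    have hφx : φ x = 0 := by simp only [hφ, hfx, zero_div]
    have hφy : φ y = 0 := by simp only [hφ, hfy, zero_div]
    obtain ⟨c, hc, hcd⟩ := exists_deriv_eq_zero hxy (hφcont x y hx) (hφx.trans hφy.symm)
    have hc0 : 0 < c := hx.trans hc.1
    have hd := (hφderiv c hc0).deriv
    rw [hcd] at hd
    have : g.eval c = 0 := by
      have hx1 : c ^ (n + 1) ≠ 0 := pow_ne_zero _ hc0.ne'
      field_simp at hd
      linarith [hd]
    exact ⟨c, hc.1, hc.2, this⟩
  by_cases hse : s = ∅
  · have h0 : f.roots.countP (fun x => 0 < x) = 0 := by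
      rw [countP_posRoots_eq_sum_rootMultiplicity, ← hs, hse, Finset.sum_empty]
    rw [h0]; exact Nat.zero_le _
  -- the largest positive root `r`
  obtain ⟨r, hr⟩ : s.Nonempty := Finset.nonempty_iff_ne_empty.mpr hse
  set r := s.max' ⟨r, hr⟩ with hrdef
  have hrs : r ∈ s := Finset.max'_mem _ _
  have hrroot : f.IsRoot r := ((hmem_s r).mp hrs).1
  have hr0 : 0 < r := ((hmem_s r).mp hrs).2
  have hrmax : ∀ x ∈ s, x ≤ r := fun x hx => Finset.le_max' _ _ hx
  -- (A) `f > 0` on `(r, ∞)`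
  obtain ⟨M₁, hM₁⟩ := exists_forall_ge_eval_pos f ha
  have fpos : ∀ y, r < y → 0 < f.eval y := by
    intro y hy
    by_contra hle
    rw [not_lt] at hle
    set y₁ := max y M₁ with hy₁
    have hyy₁ : y ≤ y₁ := le_max_left _ _
    have hfy₁ : 0 < f.eval y₁ := hM₁ y₁ (le_max_right _ _)
    have hcont : ContinuousOn (fun u => f.eval u) (Icc y y₁) := f.continuousOn
    have hmem : (0 : ℝ) ∈ Icc (f.eval y) (f.eval y₁) := ⟨hle, hfy₁.le⟩
    obtain ⟨c, hc, hfc⟩ := intermediate_value_Icc hyy₁ hcont hmem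
    have hcs : c ∈ s := (hmem_s c).mpr ⟨hfc, hr0.trans (lt_of_lt_of_le hy hc.1)⟩
    have := hrmax c hcs
    linarith [hc.1]
  -- (B) a point `ξ > r` with `g(ξ) > 0` (MVT for `φ` on `[r, r+1]`)
  have hφr : φ r = 0 := by simp only [hφ]; rw [hrroot.eq_zero, zero_div]
  obtain ⟨ξ, hξ, hξslope⟩ := exists_deriv_eq_slope φ (by linarith : r < r + 1) (hφcont r (r + 1) hr0)
    (hφdiff r (r + 1) hr0)
  have hξ0 : 0 < ξ := hr0.trans hξ.1
  have hgξ : 0 < g.eval ξ := by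
    have hφr1 : 0 < φ (r + 1) := by
      simp only [hφ]; exact div_pos (fpos (r + 1) (by linarith)) (pow_pos (by linarith) n)
    have hd := (hφderiv ξ hξ0).deriv
    rw [hξslope, hφr, sub_zero, add_sub_cancel_left, div_one] at hd
    have hx1 : 0 < ξ ^ (n + 1) := pow_pos hξ0 _
    have : g.eval ξ = φ (r + 1) * ξ ^ (n + 1) := by
      field_simp at hd; linarith [hd]
    rw [this]; exact mul_pos hφr1 hx1
  -- (C) a point `η > ξ` with `g(η) < 0`: `φ` overshoots `a = leadingCoeff f` and comes back
  have hEdeg : f.eraseLead.natDegree ≤ n - m := by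
    rw [natDegree_le_iff_coeff_eq_zero]
    intro j hj
    by_cases hjn : j < n
    · rw [eraseLead_coeff_of_ne j (by omega)]; exact hgap j hj hjn
    · by_cases hjn' : j = n
      · rw [hjn']; exact eraseLead_coeff_natDegree
      · rw [eraseLead_coeff_of_ne j hjn']; exact coeff_eq_zero_of_natDegree_lt (by omega)
  have hEc : f.eraseLead.coeff (n - m) = f.coeff (n - m) := eraseLead_coeff_of_ne _ (by omega)
  have hEdeg' : f.eraseLead.natDegree = n - m :=
    natDegree_eq_of_le_of_coeff_ne_zero hEdeg (by rw [hEc]; exact hb.ne')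
  have hElead : 0 < f.eraseLead.leadingCoeff := by rw [leadingCoeff, hEdeg', hEc]; exact hb
  have hφa : ∀ x, 0 < x → φ x - f.leadingCoeff = f.eraseLead.eval x / x ^ n := by
    intro x hx
    have hxn : x ^ n ≠ 0 := pow_ne_zero _ hx.ne'
    simp only [hφ]
    rw [eq_div_iff hxn, sub_mul, div_mul_cancel₀ _ hxn]
    have := congrArg (eval x) (eraseLead_add_monomial_natDegree_leadingCoeff f)
    rw [eval_add, eval_monomial] at this
    rw [← hn] at this
    linarith
  obtain ⟨M₂, hM₂⟩ := exists_forall_ge_eval_pos f.eraseLead hElead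
  set x₂ := max (ξ + 1) M₂ with hx₂
  have hx₂ξ : ξ < x₂ := lt_of_lt_of_le (by linarith) (le_max_left _ _)
  have hx₂0 : 0 < x₂ := hξ0.trans hx₂ξ
  have hover : f.leadingCoeff < φ x₂ := by
    have := hφa x₂ hx₂0
    have hpos : 0 < f.eraseLead.eval x₂ / x₂ ^ n := div_pos (hM₂ x₂ (le_max_right _ _)) (pow_pos hx₂0 n)
    linarith
  have htend : Filter.Tendsto (fun x => f.eraseLead.eval x / (X ^ n : ℝ[X]).eval x) Filter.atTop (nhds 0) := by
    apply Polynomial.div_tendsto_atTop_zero_of_degree_lt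
    rw [degree_X_pow]
    calc f.eraseLead.degree ≤ (f.eraseLead.natDegree : WithBot ℕ) := degree_le_natDegree
      _ < n := by rw [hEdeg']; exact_mod_cast (show n - m < n by omega)
  have hev : ∀ᶠ x in Filter.atTop, f.eraseLead.eval x / (X ^ n : ℝ[X]).eval x < φ x₂ - f.leadingCoeff :=
    htend.eventually (gt_mem_nhds (by linarith))
  obtain ⟨M₃, hM₃⟩ := hev.exists_forall_of_atTop
  set x₃ := max (x₂ + 1) M₃ with hx₃
  have hx₂x₃ : x₂ < x₃ := lt_of_lt_of_le (by linarith) (le_max_left _ _)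
  have hx₃0 : 0 < x₃ := hx₂0.trans hx₂x₃
  have hdown : φ x₃ < φ x₂ := by
    have h1 := hM₃ x₃ (le_max_right _ _)
    rw [eval_pow, eval_X] at h1
    have h2 := hφa x₃ hx₃0
    linarith
  obtain ⟨η, hη, hηslope⟩ := exists_deriv_eq_slope φ hx₂x₃ (hφcont x₂ x₃ hx₂0) (hφdiff x₂ x₃ hx₂0)
  have hη0 : 0 < η := hx₂0.trans hη.1
  have hgη : g.eval η < 0 := by
    have hd := (hφderiv η hη0).deriv
    rw [hηslope] at hd
    have hneg : (φ x₃ - φ x₂) / (x₃ - x₂) < 0 := div_neg_of_neg_of_pos (by linarith) (by linarith)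
    rw [hd] at hneg
    have hx1 : 0 < η ^ (n + 1) := pow_pos hη0 _
    by_contra hge; rw [not_lt] at hge
    have := div_nonneg hge hx1.le
    linarith
  -- (D) a root `z` of `g` in `(ξ, η)`, beyond `r`
  have hcontg : ContinuousOn (fun u => g.eval u) (Icc ξ η) := g.continuousOn
  obtain ⟨z, hz, hgz⟩ := intermediate_value_Ioo' (hx₂ξ.trans hη.1).le hcontg ⟨hgη, hgξ⟩
  have hzr : r < z := hξ.1.trans hz.1
  have hzt : z ∈ t := (hmem_t z).mpr ⟨hgz, hr0.trans hzr⟩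
  -- interleave `insert (z+1) s` with `t`
  set Mz := z + 1 with hMz
  have hMs : Mz ∉ s := fun hM => by have := hrmax Mz hM; linarith
  have key : (insert Mz s).card ≤ (t \ insert Mz s).card + 1 := by
    refine Finset.card_le_sdiff_of_interleaved fun x hx y hy hxy hno => ?_
    rw [Finset.mem_insert] at hx hy
    rcases hy with rfl | hy
    · rcases hx with rfl | hx
      · exact absurd hxy (lt_irrefl _)
      have hxr : x = r := by
        rcases lt_or_eq_of_le (hrmax x hx) with hlt | heq
        · exfalso
          exact hno r (Finset.mem_insert_of_mem hrs) ⟨hlt, by linarith⟩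
        · exact heq
      subst hxr
      exact ⟨z, hzt, hzr, by linarith⟩
    · rcases hx with rfl | hx
      · have := hrmax y hy; exact absurd hxy (by linarith)
      · have hxm := (hmem_s x).mp hx
        have hym := (hmem_s y).mp hy
        obtain ⟨c, hc1, hc2, hgc⟩ := rolle x y hxm.2 hxy hxm.1 hym.1
        exact ⟨c, (hmem_t c).mpr ⟨hgc, hxm.2.trans hc1⟩, hc1, hc2⟩
  rw [Finset.card_insert_of_notMem hMs] at key
  have hsub : t \ insert Mz s ⊆ t \ s := Finset.sdiff_subset_sdiff (le_refl t) (Finset.subset_insert _ _)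
  have hle : (t \ insert Mz s).card ≤ (t \ s).card := Finset.card_le_card hsub
  have := countP_posRoots_add_le_of_interleaved f g hgne 1 hmult (by rw [← hs, ← ht]; omega)
  omega

/-- **TOP-KILL LEMMA, with multiplicity.**  For a real polynomial `f` of degree `n ≥ m ≥ 1` with `f.coeff j = 0`
for `n − m < j < n` and `f.leadingCoeff · f.coeff (n − m) > 0` (the two HIGHEST coefficients have the same sign),
the Euler twist at the top exponent loses no positive root, multiplicities included:
`#Z₊^{mult}(f) ≤ #Z₊^{mult}(X·f′ − n·f)`. [folklore] -/
theorem countP_posRoots_le_countP_posRoots_topTwist_of_topKill (f : ℝ[X]) {m : ℕ} (hm : 1 ≤ m)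
    (hmn : m ≤ f.natDegree) (hgap : ∀ j, f.natDegree - m < j → j < f.natDegree → f.coeff j = 0)
    (hsame : 0 < f.leadingCoeff * f.coeff (f.natDegree - m)) :
    f.roots.countP (fun x => 0 < x) ≤
      (X * derivative f - C (f.natDegree : ℝ) * f).roots.countP (fun x => 0 < x) := by
  rcases lt_or_gt_of_ne (show f.leadingCoeff ≠ 0 from fun h0 => by
      rw [h0, zero_mul] at hsame; exact lt_irrefl 0 hsame) with hneg | hposc
  · have hb : f.coeff (f.natDegree - m) < 0 := by
      by_contra hc; rw [not_lt] at hc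
      have := mul_nonpos_of_nonpos_of_nonneg hneg.le hc; linarith
    have h1 := countP_posRoots_le_countP_posRoots_topTwist_of_topKill_pos (-f) hm
      (by rw [natDegree_neg]; exact hmn)
      (fun j hj1 hj2 => by
        rw [natDegree_neg] at hj1 hj2; rw [coeff_neg, hgap j hj1 hj2, neg_zero])
      (by rw [leadingCoeff_neg]; linarith) (by rw [natDegree_neg, coeff_neg]; linarith)
    rw [natDegree_neg, roots_neg, derivative_neg] at h1
    have e : (X * -derivative f - C (f.natDegree : ℝ) * -f) = -(X * derivative f - C (f.natDegree : ℝ) * f) := by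
      ring
    rwa [e, roots_neg] at h1
  · have hb : 0 < f.coeff (f.natDegree - m) := by
      by_contra hc; rw [not_lt] at hc
      have := mul_nonpos_of_nonneg_of_nonpos hposc.le hc; linarith
    exact countP_posRoots_le_countP_posRoots_topTwist_of_topKill_pos f hm hmn hgap hposc hb

/-! ### The trinomial lemma with multiplicity -/

/-- **Trinomial lemma, with multiplicity.**  If the real trinomial `A·Xⁱ + B·X^{i+a} + C·X^{i+a+b}` (`a, b ≥ 1`)
has at least two positive roots COUNTED WITH MULTIPLICITY, then
`(a+b)^{a+b} · |A|^b · |C|^a ≤ |B|^{a+b} · a^a · b^b`.  Two distinct roots: the tree's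
`trinomial_two_posRoots_le`.  One positive root `r` of multiplicity `≥ 2`: `T(r) = T′(r) = 0`, so the Euler
twist at the middle exponent gives `a·A·rⁱ = b·C·r^{i+a+b}`; hence `A·C > 0` (for `A·C < 0` this is absurd),
and weighted AM–GM at the root `r` gives the inequality (with equality, in fact). [folklore] -/
theorem trinomial_two_posRoots_le_of_countP {i a b : ℕ} (ha : 0 < a) (hb : 0 < b) (A B Cc : ℝ)
    (h2 : 2 ≤ (C A * X ^ i + C B * X ^ (i + a) + C Cc * X ^ (i + a + b)).roots.countP (fun x => 0 < x)) :
    ((a : ℝ) + b) ^ (a + b) * |A| ^ b * |Cc| ^ a ≤ |B| ^ (a + b) * (a : ℝ) ^ a * (b : ℝ) ^ b := by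
  classical
  by_cases hd : 1 < ((C A * X ^ i + C B * X ^ (i + a) + C Cc * X ^ (i + a + b)).roots.toFinset.filter
      (fun x => 0 < x)).card
  · exact trinomial_two_posRoots_le ha hb A B Cc hd
  -- trivial when an outer coefficient vanishes
  by_cases hA : A = 0
  · subst hA
    rw [abs_zero, zero_pow hb.ne', mul_zero, zero_mul]
    positivity
  by_cases hC : Cc = 0
  · subst hC
    rw [abs_zero, zero_pow ha.ne', mul_zero]
    positivity
  set T : ℝ[X] := C A * X ^ i + C B * X ^ (i + a) + C Cc * X ^ (i + a + b) with hT
  have hT0 : T ≠ 0 := by intro h; rw [h] at h2; simp at h2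
  set s := T.roots.toFinset.filter (fun x => 0 < x) with hs
  rw [not_lt] at hd
  -- exactly one distinct positive root `r`, of multiplicity `≥ 2`
  have hsum := countP_posRoots_eq_sum_rootMultiplicity T
  rw [← hs] at hsum
  have hsne : s.Nonempty := by
    rw [Finset.nonempty_iff_ne_empty]; intro he
    rw [he, Finset.sum_empty] at hsum; omega
  obtain ⟨r, hr⟩ := hsne
  have hs1 : s = {r} :=
    Finset.eq_singleton_iff_unique_mem.mpr ⟨hr, fun x hx => Finset.card_le_one.mp hd x hx r hr⟩
  have hrmem := hr
  rw [hs, Finset.mem_filter, Multiset.mem_toFinset, mem_roots hT0] at hrmem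
  obtain ⟨hroot, hr0⟩ := hrmem
  rw [hs1, Finset.sum_singleton] at hsum
  have hmr : 2 ≤ T.rootMultiplicity r := by omega
  -- `T′(r) = 0`
  have hder : T.derivative.IsRoot r := by
    have h1 := rootMultiplicity_sub_one_le_derivative_rootMultiplicity T r
    have h2' : 0 < T.derivative.rootMultiplicity r := by omega
    exact (rootMultiplicity_pos'.mp h2').2
  -- the Euler twist at the middle exponent, evaluated at `r`
  have e3 : T = ∑ t : Fin 3, C ((![A, B, Cc] : Fin 3 → ℝ) t) * X ^ ((![i, i + a, i + a + b] : Fin 3 → ℕ) t) := by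
    rw [Fin.sum_univ_three]
    simp only [Matrix.cons_val_zero, Matrix.cons_val_one, Matrix.cons_val]
    exact hT
  have htw0 : (X * derivative T - C ((i : ℝ) + a) * T).eval r = 0 := by
    rw [eval_sub, eval_mul, eval_X, eval_mul, eval_C, hroot.eq_zero, hder.eq_zero, mul_zero, mul_zero, sub_zero]
  have htw : (X * derivative T - C ((i : ℝ) + a) * T).eval r
      = -(a : ℝ) * A * r ^ i + (b : ℝ) * Cc * r ^ (i + a + b) := by
    rw [e3, twist_sum_C_mul_X_pow, eval_finsetSum, Fin.sum_univ_three]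
    simp only [Matrix.cons_val_zero, Matrix.cons_val_one, Matrix.cons_val, eval_mul, eval_C, eval_pow, eval_X]
    push_cast
    ring
  rw [htw] at htw0
  -- `a·A·rⁱ = b·C·r^{i+a+b}` forces `A·C > 0`
  have hri : 0 < r ^ i := pow_pos hr0 _
  have hrt : 0 < r ^ (i + a + b) := pow_pos hr0 _
  have ha' : (0 : ℝ) < a := by exact_mod_cast ha
  have hb' : (0 : ℝ) < b := by exact_mod_cast hb
  have hAC : 0 < A * Cc := by
    rcases lt_or_gt_of_ne (mul_ne_zero hA hC) with hneg | hpos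
    · exfalso
      -- multiply the relation by `Cc`: `a·(A·Cc)·rⁱ = b·Cc²·r^{i+a+b}`
      have hrel : (a : ℝ) * (A * Cc) * r ^ i = (b : ℝ) * Cc ^ 2 * r ^ (i + a + b) := by
        have : (a : ℝ) * A * r ^ i = (b : ℝ) * Cc * r ^ (i + a + b) := by linarith
        calc (a : ℝ) * (A * Cc) * r ^ i = ((a : ℝ) * A * r ^ i) * Cc := by ring
          _ = ((b : ℝ) * Cc * r ^ (i + a + b)) * Cc := by rw [this]
          _ = (b : ℝ) * Cc ^ 2 * r ^ (i + a + b) := by ring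
      have hl : (a : ℝ) * (A * Cc) * r ^ i < 0 :=
        mul_neg_of_neg_of_pos (mul_neg_of_pos_of_neg ha' hneg) hri
      have hC2 : 0 < Cc ^ 2 := by positivity
      have hrhs : 0 < (b : ℝ) * Cc ^ 2 * r ^ (i + a + b) := by positivity
      linarith
    · exact hpos
  -- same signs: `|B| = |A| r⁻ᵃ + |Cc| rᵇ`, then AM–GM (as in `trinomial_two_posRoots_le`)
  have rel : A * r⁻¹ ^ a + B + Cc * r ^ b = 0 := by
    have h : A * r ^ i + B * r ^ (i + a) + Cc * r ^ (i + a + b) = 0 := by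
      have := hroot.eq_zero
      simp only [hT, eval_add, eval_mul, eval_C, eval_pow, eval_X] at this
      exact this
    have hxne : r ≠ 0 := hr0.ne'
    have hxa : r ^ a ≠ 0 := pow_ne_zero _ hxne
    have hxia : r ^ (i + a) ≠ 0 := pow_ne_zero _ hxne
    have key : r ^ (i + a) * (A * r⁻¹ ^ a + B + Cc * r ^ b)
        = A * r ^ i + B * r ^ (i + a) + Cc * r ^ (i + a + b) := by
      rw [inv_pow, pow_add, pow_add, pow_add]
      calc r ^ i * r ^ a * (A * (r ^ a)⁻¹ + B + Cc * r ^ b)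
          = A * r ^ i * (r ^ a * (r ^ a)⁻¹) + B * (r ^ i * r ^ a) + Cc * (r ^ i * r ^ a * r ^ b) := by
            ring
        _ = A * r ^ i + B * (r ^ i * r ^ a) + Cc * (r ^ i * r ^ a * r ^ b) := by
            rw [mul_inv_cancel₀ hxa, mul_one]
    exact (mul_eq_zero.mp (key.trans h)).resolve_left hxia
  have hP : 0 ≤ |A| * r⁻¹ ^ a := by positivity
  have hQ : 0 ≤ |Cc| * r ^ b := by positivity
  have hB : |B| = |A| * r⁻¹ ^ a + |Cc| * r ^ b := by
    have hB' : B = -(A * r⁻¹ ^ a + Cc * r ^ b) := by linarith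
    rw [hB', abs_neg]
    rcases lt_or_gt_of_ne hA with hA' | hA'
    · have hC' : Cc < 0 := by nlinarith
      have h1 : A * r⁻¹ ^ a ≤ 0 := mul_nonpos_of_nonpos_of_nonneg hA'.le (by positivity)
      have h2 : Cc * r ^ b ≤ 0 := mul_nonpos_of_nonpos_of_nonneg hC'.le (by positivity)
      rw [abs_of_nonpos (by linarith), abs_of_neg hA', abs_of_neg hC']
      ring
    · have hC' : 0 < Cc := by nlinarith
      have h1 : 0 ≤ A * r⁻¹ ^ a := by positivity
      have h2 : 0 ≤ Cc * r ^ b := by positivity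
      rw [abs_of_nonneg (by linarith), abs_of_pos hA', abs_of_pos hC']
  have am := amgm_pow_nat ha hb hP hQ
  rw [← hB] at am
  have hxne : r ≠ 0 := hr0.ne'
  have hone : (r⁻¹ ^ a) ^ b * (r ^ b) ^ a = 1 := by
    rw [← pow_mul, ← pow_mul, mul_comm b a, ← mul_pow, inv_mul_cancel₀ hxne, one_pow]
  have hprod : (|A| * r⁻¹ ^ a) ^ b * (|Cc| * r ^ b) ^ a = |A| ^ b * |Cc| ^ a := by
    calc (|A| * r⁻¹ ^ a) ^ b * (|Cc| * r ^ b) ^ a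
        = |A| ^ b * |Cc| ^ a * ((r⁻¹ ^ a) ^ b * (r ^ b) ^ a) := by ring
      _ = |A| ^ b * |Cc| ^ a := by rw [hone, mul_one]
  calc ((a : ℝ) + b) ^ (a + b) * |A| ^ b * |Cc| ^ a
      = ((a : ℝ) + b) ^ (a + b) * (|A| * r⁻¹ ^ a) ^ b * (|Cc| * r ^ b) ^ a := by
        rw [mul_assoc, ← hprod, ← mul_assoc]
    _ ≤ |B| ^ (a + b) * (a : ℝ) ^ a * (b : ℝ) ^ b := am

end Summit.ValiantsHypothesis.ValiantsHypothesis.Theorems.LacunarySymmetroidMatrixDescartes.Census
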